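import Summits.QuantumFields.YangMills.Theorems.IR.Negative.OnsetSharpSCFalseWithoutLowerBounds

/-!
# Crux `IR` (stmt-QuantumFields-19354), slot `af-pincer-Uc` sharp re-cut (skeleton 28967a1bf60ad397, owner R104):
# K-SM∞ on the I♯ side in sharp form — the kill-world of `stub_onsetSharpSC`, its completeness, and the void ε-freedom

Refuter lane B `ym-cdisprove-19354-afonset` (gen 2), strategy B; companion of `OnsetSharpSCFalseWithoutLowerBounds.lean` (the NT calibration
`LowerBounds` is load-bearing).  Negative-lane module for item `stmt-QuantumFields-19354` (`--supports`; closes nothing, asserts no Theses decl).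

WHAT IS PROVED (sorry-free; axioms `propext`, `Classical.choice`, `Quot.sound`):

* §5 `NoEarlyOnsetAt` (p528589's `LateOnsetAt` minus its format-existence conjunct, with the strict `<` of I♯_SC), `KSMInfSharp` (ONE simply
  connected NT-calibrated `(G, r, a)` with no early onset at EVERY admissible `(n, ε)`, some budget each) and
  **`not_onsetSharpUKPcSC_iff_ksmInfSharp : ¬ OnsetSharpUKPcSC ↔ KSMInfSharp`** — the kill-world is COMPLETE (it loses nothing: refuting the
  stub and instantiating `KSMInfSharp` are the same task, and an instance needs ONE NT-calibrated unit map, which the tree cannot construct —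
  whereas WITHOUT that constraint the instance exists, companion §4); the §5 hook of `AfPincerUcSharpOnset`
  (`not_onsetSharpUKPcSC_of_lateOnsetAt`) factors through it (`ksmInfSharp_of_lateOnset`).
* §6 the ε-freedom of the supplier is VOID: `noEarlyOnsetAt_anti` (failure at larger budgets ⇒ failure at smaller), `maxTol n := 3/(4·shellCount n)`,
  `ksmInfSharp_iff_maxTol` (the kill-world is the ONE-parameter family `n ↦ (n, maxTol n, δ_n)`), and dually for provers
  `onsetSharpUKPcSC_iff_maxTol` (WLOG `ε = maxTol n`: only `n` and the `δ`-dependence of the calibrated mesh are real choices).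

HONEST FRAMING: a typed, uninstantiated kill-world for ONE open stub of a CONDITIONAL reduction chain (Track A 0/28 UV); `KSMInfSharp` is NOT
asserted (judged empty at physics grade for simply connected `G`: cdisprove g0 memo `KSM-VERDICT.md` cad25bdadf3fb41d, census M1–M9, which is
`(n, ε, δ)`-blind, so it transfers verbatim); nothing here proves or refutes weak-coupling mixing or a mass gap; not Clay.
-/

set_option autoImplicit false

noncomputable section

open Filter Topology MeasureTheory
open Literature.MathematicalPhysics.QuantumFieldTheory Literature.MathematicalPhysics.QuantumLattice
open Summit.QuantumFields.YangMills.Cruxes.OSLegsFromFemtoAndGap.DlrCollarTransfer (LowerBounds)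

namespace Summit.QuantumFields.YangMills.Cruxes.IR.AfPincerUc.SharpOnset

open Summit.QuantumFields.YangMills.Cruxes.IR.AfPincerUc

/-! ## §5 K-SM∞ on the I♯ side, sharp form: `NoEarlyOnsetAt`, `KSMInfSharp`, completeness -/
section KSMSharp

variable {G : Type} [Group G] [TopologicalSpace G] [IsTopologicalGroup G] [CompactSpace G]

section
variable [MeasurableSpace G] [BorelSpace G]

/-- **No early onset at `(G, r, a, n, ε, δ)`**: for every calibration factor `T`, cofinally in `β`, format Uc fails at EVERY mesh `b ≥ 1` with
`a β · b < T`.  (p528589's `LateOnsetAt` minus the conjunct «the format holds at some mesh», and with the strict `<` of I♯_SC; so the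
wire worlds, where the format holds at NO mesh, populate it too.) -/
def NoEarlyOnsetAt (r : LatticeRep G) (a : ℝ → ℝ) (n : ℕ) (ε δ : ℝ) : Prop :=
  ∀ T β₁ : ℝ, ∃ β : ℝ, β₁ ≤ β ∧ ∀ b : ℕ, 1 ≤ b → a β * (b : ℝ) < T → ¬ TypShellCondUKPc r.ρ β b n ε δ

/-- A late onset (p528589) is in particular no early onset. -/
theorem noEarlyOnsetAt_of_lateOnsetAt {r : LatticeRep G} {a : ℝ → ℝ} {n : ℕ} {ε δ : ℝ}
    (h : LateOnsetAt r a n ε δ) : NoEarlyOnsetAt r a n ε δ := by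
  intro T β₁
  obtain ⟨β, hβ, -, hfail⟩ := h T β₁
  exact ⟨β, hβ, fun b hb hlt => hfail b hb hlt.le⟩

/-- **The ε-freedom is void on the kill side**: no early onset at budgets `(ε', δ')` gives no early onset at every `(ε, δ)` with
`ε ≤ ε'`, `0 ≤ δ ≤ δ'` (format Uc is monotone, §1). -/
theorem noEarlyOnsetAt_anti {r : LatticeRep G} {a : ℝ → ℝ} {n : ℕ} {ε ε' δ δ' : ℝ} (hε : ε ≤ ε') (hδ0 : 0 ≤ δ)
    (hδ : δ ≤ δ') (h : NoEarlyOnsetAt r a n ε' δ') : NoEarlyOnsetAt r a n ε δ := by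
  intro T β₁
  obtain ⟨β, hβ, hfail⟩ := h T β₁
  exact ⟨β, hβ, fun b hb hlt hU => hfail b hb hlt (typShellCondUKPc_mono hε hδ0 hδ hU)⟩

end

/-- **K-SM∞♯ — the kill-world of `stub_onsetSharpSC`**: one admissible SIMPLY CONNECTED `(G, r)` with a positive NT-calibrated unit map
`a → 0` (`LowerBounds G r a`) at which EVERY admissible `(n, ε)` has no early onset for some budget `δ > 0`.  A closed `Prop`, NOT asserted and
NOT instantiated (an instance needs a non-triviality floor at units `→ 0`); by `not_onsetSharpUKPcSC_iff_ksmInfSharp` it is literally `¬ I♯_SC`. -/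
def KSMInfSharp : Prop :=
  ∃ (G : Type) (_ : Group G) (_ : TopologicalSpace G) (_ : IsTopologicalGroup G) (_ : CompactSpace G),
    IsCompactSimpleLieGroup G ∧ SimplyConnectedSpace G ∧
      (letI : MeasurableSpace G := borel G; haveI : BorelSpace G := ⟨rfl⟩;
        ∃ (r : LatticeRep G) (a : ℝ → ℝ), (∀ β, 0 < a β) ∧ Tendsto a atTop (𝓝 0) ∧ LowerBounds G r a ∧
          ∀ (n : ℕ) (ε : ℝ), 1 ≤ n → 0 ≤ ε → ε * OnsetFormats.shellCount n ≤ 3 / 4 →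
            ∃ δ : ℝ, 0 < δ ∧ NoEarlyOnsetAt r a n ε δ)

/-- `KSMInfSharp → ¬ I♯_SC`. -/
theorem not_onsetSharpUKPcSC_of_ksmInfSharp (h : KSMInfSharp) : ¬ OnsetSharpUKPcSC := by
  obtain ⟨G, _, _, _, _, hG, hsc, r, a, ha, hat, hlb, hall⟩ := h
  letI : MeasurableSpace G := borel G
  haveI : BorelSpace G := ⟨rfl⟩
  intro hS
  obtain ⟨n, ε, hn, hε, hM, hδT⟩ := hS G hG hsc r a ha hat hlb
  obtain ⟨δ, hδ, hne⟩ := hall n ε hn hε hM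
  obtain ⟨T, β₂, hb⟩ := hδT δ hδ
  obtain ⟨β, hβ, hfail⟩ := hne T β₂
  obtain ⟨b, hb1, hlt, hP⟩ := hb β hβ
  exact hfail b hb1 hlt hP

/-- `¬ I♯_SC → KSMInfSharp`: the negation of the registered stub, pushed through its binders, IS the kill-world. -/
theorem ksmInfSharp_of_not_onsetSharpUKPcSC (hS : ¬ OnsetSharpUKPcSC) : KSMInfSharp := by
  by_contra hK
  apply hS
  intro G _ _ _ _ hG hsc
  letI : MeasurableSpace G := borel G
  haveI : BorelSpace G := ⟨rfl⟩
  intro r a ha hat hlb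
  by_contra hcon
  apply hK
  refine ⟨G, inferInstance, inferInstance, inferInstance, inferInstance, hG, hsc, r, a, ha, hat, hlb, ?_⟩
  intro n ε hn hε hM
  by_contra hδ
  apply hcon
  refine ⟨n, ε, hn, hε, hM, fun δ hδpos => ?_⟩
  by_contra hT
  apply hδ
  refine ⟨δ, hδpos, fun T β₁ => ?_⟩
  by_contra hβ
  apply hT
  refine ⟨T, β₁, fun β hβ1 => ?_⟩
  by_contra hb
  apply hβ
  exact ⟨β, hβ1, fun b hb1 hlt hP => hb ⟨b, hb1, hlt, hP⟩⟩

/-- **Completeness of the kill-world (PROVED): `¬ I♯_SC ↔ K-SM∞♯`.**  Refuting `stub_onsetSharpSC` and instantiating `KSMInfSharp` are the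
same task; in particular a refutation needs ONE NT-calibrated unit map (`LowerBounds`), which the tree cannot construct (cf. §4: without that
constraint the instance exists). -/
theorem not_onsetSharpUKPcSC_iff_ksmInfSharp : ¬ OnsetSharpUKPcSC ↔ KSMInfSharp :=
  ⟨ksmInfSharp_of_not_onsetSharpUKPcSC, not_onsetSharpUKPcSC_of_ksmInfSharp⟩

/-- The §5 hook of `AfPincerUcSharpOnset` factors through the kill-world: late onset (p528589 currency) at every admissible `(n, ε)` of one
simply connected NT-calibrated `(G, r, a)` populates `KSMInfSharp`. -/
theorem ksmInfSharp_of_lateOnset (G : Type) [Group G] [TopologicalSpace G] [IsTopologicalGroup G]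
    [CompactSpace G] (hG : IsCompactSimpleLieGroup G) (hsc : SimplyConnectedSpace G)
    (h : letI : MeasurableSpace G := borel G; haveI : BorelSpace G := ⟨rfl⟩;
      ∃ (r : LatticeRep G) (a : ℝ → ℝ), (∀ β, 0 < a β) ∧ Tendsto a atTop (𝓝 0) ∧ LowerBounds G r a ∧
        ∀ (n : ℕ) (ε : ℝ), 1 ≤ n → 0 ≤ ε → ε * OnsetFormats.shellCount n ≤ 3 / 4 →
          ∃ δ : ℝ, 0 < δ ∧ LateOnsetAt r a n ε δ) : KSMInfSharp := by
  letI : MeasurableSpace G := borel G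
  haveI : BorelSpace G := ⟨rfl⟩
  obtain ⟨r, a, ha, hat, hlb, hall⟩ := h
  refine ⟨G, inferInstance, inferInstance, inferInstance, inferInstance, hG, hsc, r, a, ha, hat, hlb, ?_⟩
  intro n ε hn hε hM
  obtain ⟨δ, hδ, hlate⟩ := hall n ε hn hε hM
  exact ⟨δ, hδ, noEarlyOnsetAt_of_lateOnsetAt hlate⟩

end KSMSharp

/-! ## §6 The supplier's ε-freedom is void: maximal tolerance -/
section MaxTol

/-- The maximal admissible mixing budget at window parameter `n`: `ε · shellCount n ≤ 3/4 ⟺ ε ≤ maxTol n`. -/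
def maxTol (n : ℕ) : ℝ := 3 / (4 * OnsetFormats.shellCount n)

/-- The maximal tolerance is non-negative. -/
theorem maxTol_nonneg (n : ℕ) : 0 ≤ maxTol n := by
  unfold maxTol; exact div_nonneg (by norm_num) (by positivity [shellCount_pos n])

/-- The maximal tolerance saturates the admissibility constraint: `maxTol n · shellCount n = 3/4`. -/
theorem maxTol_mul_shellCount (n : ℕ) : maxTol n * OnsetFormats.shellCount n = 3 / 4 := by
  unfold maxTol
  have h := (shellCount_pos n).ne'
  field_simp

/-- Every admissible mixing budget is at most the maximal tolerance. -/
theorem le_maxTol_of_admissible {n : ℕ} {ε : ℝ} (hM : ε * OnsetFormats.shellCount n ≤ 3 / 4) : ε ≤ maxTol n := by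
  unfold maxTol
  rw [le_div_iff₀ (by positivity [shellCount_pos n])]
  linarith

/-- **K-SM∞♯ at maximal tolerance**: the ONE-parameter kill-world `n ↦ (n, maxTol n, δ_n)`. -/
def KSMInfSharpMaxTol : Prop :=
  ∃ (G : Type) (_ : Group G) (_ : TopologicalSpace G) (_ : IsTopologicalGroup G) (_ : CompactSpace G),
    IsCompactSimpleLieGroup G ∧ SimplyConnectedSpace G ∧
      (letI : MeasurableSpace G := borel G; haveI : BorelSpace G := ⟨rfl⟩;
        ∃ (r : LatticeRep G) (a : ℝ → ℝ), (∀ β, 0 < a β) ∧ Tendsto a atTop (𝓝 0) ∧ LowerBounds G r a ∧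
          ∀ n : ℕ, 1 ≤ n → ∃ δ : ℝ, 0 < δ ∧ NoEarlyOnsetAt r a n (maxTol n) δ)

/-- **The kill-world is one-parametric (PROVED): `KSMInfSharp ↔ KSMInfSharpMaxTol`** — no early onset at `(n, maxTol n, δ_n)` for every
`n ≥ 1` is the whole of K-SM∞♯ (§1 monotonicity). -/
theorem ksmInfSharp_iff_maxTol : KSMInfSharp ↔ KSMInfSharpMaxTol := by
  constructor
  · rintro ⟨G, _, _, _, _, hG, hsc, r, a, ha, hat, hlb, hall⟩
    refine ⟨G, inferInstance, inferInstance, inferInstance, inferInstance, hG, hsc, r, a, ha, hat, hlb, ?_⟩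
    intro n hn
    exact hall n (maxTol n) hn (maxTol_nonneg n) (maxTol_mul_shellCount n).le
  · rintro ⟨G, _, _, _, _, hG, hsc, r, a, ha, hat, hlb, hall⟩
    letI : MeasurableSpace G := borel G
    haveI : BorelSpace G := ⟨rfl⟩
    refine ⟨G, inferInstance, inferInstance, inferInstance, inferInstance, hG, hsc, r, a, ha, hat, hlb, ?_⟩
    intro n ε hn hε hM
    obtain ⟨δ, hδ, hne⟩ := hall n hn
    exact ⟨δ, hδ, noEarlyOnsetAt_anti (le_maxTol_of_admissible hM) hδ.le le_rfl hne⟩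

/-- **I♯_SC at maximal tolerance** (the supplier names only `n`; `ε := maxTol n`). -/
def OnsetSharpUKPcSCMaxTol : Prop :=
  ∀ (G : Type) [Group G] [TopologicalSpace G] [IsTopologicalGroup G] [CompactSpace G],
    IsCompactSimpleLieGroup G → SimplyConnectedSpace G →
    letI : MeasurableSpace G := borel G; haveI : BorelSpace G := ⟨rfl⟩;
    ∀ (r : LatticeRep G) (a : ℝ → ℝ), (∀ β, 0 < a β) → Tendsto a atTop (𝓝 0) → LowerBounds G r a →
      ∃ n : ℕ, 1 ≤ n ∧ ∀ δ : ℝ, 0 < δ → ∃ T β₂ : ℝ, ∀ β : ℝ, β₂ ≤ β →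
        ∃ b : ℕ, 1 ≤ b ∧ a β * (b : ℝ) < T ∧ TypShellCondUKPc r.ρ β b n (maxTol n) δ

/-- **WLOG maximal tolerance (PROVED): `I♯_SC ↔ I♯_SC at ε = maxTol n`** — for a prover of `stub_onsetSharpSC` the only real choices
are the window parameter `n` and the `δ`-dependence of the calibrated mesh. -/
theorem onsetSharpUKPcSC_iff_maxTol : OnsetSharpUKPcSC ↔ OnsetSharpUKPcSCMaxTol := by
  constructor
  · intro h G _ _ _ _ hG hsc
    letI : MeasurableSpace G := borel G
    haveI : BorelSpace G := ⟨rfl⟩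
    intro r a ha hat hlb
    obtain ⟨n, ε, hn, -, hM, hδT⟩ := h G hG hsc r a ha hat hlb
    refine ⟨n, hn, fun δ hδ => ?_⟩
    obtain ⟨T, β₂, hb⟩ := hδT δ hδ
    refine ⟨T, β₂, fun β hβ => ?_⟩
    obtain ⟨b, hb1, hlt, hU⟩ := hb β hβ
    exact ⟨b, hb1, hlt, typShellCondUKPc_mono (le_maxTol_of_admissible hM) hδ.le le_rfl hU⟩
  · intro h G _ _ _ _ hG hsc
    letI : MeasurableSpace G := borel G
    haveI : BorelSpace G := ⟨rfl⟩
    intro r a ha hat hlb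
    obtain ⟨n, hn, hδT⟩ := h G hG hsc r a ha hat hlb
    exact ⟨n, maxTol n, hn, maxTol_nonneg n, (maxTol_mul_shellCount n).le, hδT⟩

end MaxTol

end Summit.QuantumFields.YangMills.Cruxes.IR.AfPincerUc.SharpOnset

end
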